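import Literature.MathematicalPhysics.QuantumFieldTheory.YangMillsEuclidean
import Literature.MathematicalPhysics.QuantumFieldTheory.Wightman
import Literature.MathematicalPhysics.QuantumFieldTheory.LatticeGauge
import Literature.MathematicalPhysics.QuantumFieldTheory.Sweep1
import Literature.MathematicalPhysics.QuantumFieldTheory.QCD
import HarnessLib
import HarnessLib.Audit
import HarnessLib.Audit.TribunalTags

/-!
# Strong-Hypothesis Library — summit `QuantumFields` (D-0034, skeleton)

The REGISTRY of known strong hypotheses `H` (open conjectures with `H ⇒ P` landed or printed), of
known EQUIVALENT REFORMULATIONS `E`, and — this summit's peculiarity — of COGNATE READINGS of the same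
printed problem, for the two-problem summit `QuantumFields := YangMills ∧ QCD`
(`Summits/QuantumFields/Statement.lean`). Every entry carries `@[strong_hypothesis "QuantumFields.<P>"]`
with `<P> ∈ {YangMills, QCD}`; the kernel tribunal (`#h21_tribunal`, D-0033 T1 rule (a)) probes each
registered `H` against a route crux `C` for `H → C`. Bridges live summit-side in
`Summits/QuantumFields/StrongHypotheses.lean`. Nothing already in the tree is restated; existing
conjecture `def`s are tagged in place. NO new hypothesis is stated in this skeleton (see "Why the
library is thin" below).

## The problems

* `YangMills` (`_root_.YangMills`, `Summits/QuantumFields/YangMills/Statement.lean`) — Jaffe–Witten 2000,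
  §4, verbatim (D-0018(2)): for EVERY compact simple Lie group `G` there are a faithful unitary lattice
  representation `r`, a sequential weak-coupling scaling scheme `sch` (`a_k → 0`, `a_k L_k → ∞`,
  `β_k → ∞`), and Osterwalder–Schrader data `T : OSData (YMSpecies G) 4` for ALL gauge-invariant local
  observables, with `IsYangMillsFor r sch T` (joint continuum limit of Wilson's lattice theory),
  non-trivial non-Gaussian curvature field, and ONE mass gap `Δ > 0` of the FULL Hamiltonian both in the
  continuum (`T.HasMassGap Δ`) and on the lattices uniformly in spacing and volume (`HasLatticeMassGap`).
* `QCD` (`_root_.QCD := QCDOf 2 ∧ QCDOf 3`, `Summits/QuantumFields/QCD/Statement.lean`) — no official text;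
  Jaffe–Witten 2000 §1 (1), §5; human rulings 2026-08-15/16: ONE mass-independent `SU(3)` Wilson-fermion
  regularisation, chiral at zero, with two-loop asymptotic scaling and universal mass scaling, such that
  for EVERY tuple of positive renormalised quark masses there are joint OS data for `glue` and the
  pseudoscalar bilinears which ARE lattice QCD's continuum limit, non-trivial, with dynamical quarks and
  one full-spectrum mass gap (continuum and lattice), for `N_f = 2` and `N_f = 3`.

## Why the library is thin (honest reading of the literature)

Both problems are BESPOKE renderings (species-indexed OS data tied to a lattice scheme, full-spectrum
gap, `∀ G` resp. `∀ m > 0`). No conjecture in print is proved — in print or in the tree — to imply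
either of them literally: the constructive-QFT literature poses the Clay problem in several
NON-EQUIVALENT precise forms (Jaffe–Witten §4 leaves the axiom scheme at "at least as strong as
[Streater–Wightman, Osterwalder–Schrader]"; Chatterjee 2019 §§4–5 gives lattice forms; Jaffe–Witten §6.5
the lattice reading) and proves no passage between them. What the tree DOES hold are four earlier
formalisations of the same Clay text and two transcriptions of Chatterjee's lattice mass-gap problem, plus
one earlier Euclidean rendering of QCD. They are registered below as COGNATE READINGS: `H → C` for such an
`H` tells the tribunal that crux `C` is (a fragment of) the Clay problem in another vocabulary — exactly
the costume it looks for — even though `H → YangMills` is NOT claimed. Every bridge is therefore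
`none`, and the summit file records why no printed bridge exists.

## Census

| # | `H` | one-line statement | relation to `P` | source | status here | bridge |
|---|---|---|---|---|---|---|
| 1 | `Literature.MathematicalPhysics.QuantumFieldTheory.ClayYangMillsEuclideanGap` (cqft.S03) | ∀ compact simple `G`, faithful unitary `ρ`: ∃ scaling scheme, OS0–OS4 probability measure `μ` on `𝒮'(ℝ⁴)`, torus-primary continuum limit in law of the smeared plaquette field, non-Gaussian, exponential clustering at some `m > 0` | COGNATE reading of `YangMills` (same Jaffe–Witten §4 text; single plaquette field instead of all species, no weak-coupling clause, no lattice-uniform gap — formally incomparable; neither direction in print or tree) | Jaffe–Witten 2000/2006 §4, §5 (2); OS 1973/75 | registered | none |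
| 2 | `Literature.MathematicalPhysics.QuantumFieldTheory.ClayYangMills` (cqft.S02) | same binders; ∃ Wightman data `W` with W0–W4, Hamiltonian mass gap `Δ`, and `IsYangMillsQuantisation ρ W` (Wick rotation of a non-Gaussian torus-primary lattice continuum limit) | COGNATE (Minkowski/Wightman form of row 1; `clayYangMills_imp_euclideanGap` unpacks it; OS reconstruction OS ⇒ W is a THEOREM, cqft.S06/S10, not a hypothesis) | Jaffe–Witten 2000 §4; Streater–Wightman 1964 | registered | none |
| 3 | `Literature.MathematicalPhysics.QuantumFieldTheory.ClayYangMillsEuclidean` (cqft.S01) | `G = SU(3)`: ∃ scheme, OS measure, torus-primary plaquette-field limit, non-Gaussian, AND continuum area law for rectangular Wilson loops | COGNATE + confinement for ONE group (stronger conclusion — area law — but `SU(3)` only and no gap clause: incomparable with `YangMills`; "area law ⇒ mass gap" is NOT a theorem in print for 4-D non-abelian theories) | Jaffe–Witten §4–5; Chatterjee 2019 Problem 4.1 | registered | none |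
| 4 | `Literature.MathematicalPhysics.QuantumFieldTheory.ClayYangMillsEuclideanAlong` | as row 3 but through infinite-volume DLR states `ν a` at each spacing (thermodynamic limit first) | COGNATE (its own docstring: "Neither form is known to imply the other") | Chatterjee 2019 §4 Pb 4.1, §5 Pb 5.1–5.2 | registered | none |
| 5 | `Literature.MathematicalPhysics.QuantumFieldTheory.LatticeMassGapAllCouplings` (cqft.S28, A9 vocabulary) | ∀ compact non-abelian `G ⊆ U(N)`, ∀ `β > 0`, ∀ infinite-volume limit `μ`: the plaquette–plaquette correlation decays at an exact exponential rate `1/ξ(β) ∈ (0,∞)`, and `ξ(β) → ∞` as `β → ∞` | LATTICE-SIDE strong hypothesis (all-coupling lattice gap): posed by Chatterjee as the lattice half of the Clay problem; it does NOT give the continuum OS data, and `YangMills`'s `HasLatticeMassGap` (gap `Δ` in PHYSICAL units along a weak-coupling sequence, all observables, uniform in volume) is neither implied by nor implies it in print — incomparable | Chatterjee, *Yang–Mills for probabilists* (2019) §5 Problem 5.1 | registered | none |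
| 6 | `Literature.MathematicalPhysics.QuantumFieldTheory.ChatterjeeMassGapProblem` (cqft.S28, wave-0 vocabulary) | the same Problem 5.1 over `ZdGaugeConfig`/`IsInfiniteVolumeLimit` (second transcription, kept by the tree for debt-accounting reasons) | as row 5 | ibid. | registered | none |
| 7 | `Literature.MathematicalPhysics.QuantumFieldTheory.QCD` (defn-QCD, first rendering) | ∀ `N_f ∈ [2,6]`: ∃ QCD scaling scheme (bare masses existential), OS measure for the plaquette field from UNQUENCHED `SU(3)` Wilson-fermion lattice QCD, non-Gaussian, exp. clustering; pion two-point functions converge, are not contact terms, and cluster at `m_π > 0` | COGNATE reading of `_root_.QCD` (∃ masses and `N_f ≤ 6` vs the summit's ∀ `m > 0` in one regularisation for `N_f = 2, 3`; single field + meson channel vs joint species OS data and full-spectrum lattice gap — incomparable; no passage in print) | Jaffe–Witten 2000 §1, §5–6; Montvay–Münster 1994 §5.1 | registered (`"QuantumFields.QCD"`) | none |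
| 8 | Chatterjee's continuum-limit problem (Problem 5.2: `log⟨W_{R/ε,T/ε}⟩ = −c(β)(R+T) − d RT + o(1)` along `β → ∞`, `ε(β) → 0`) | Wilson-loop continuum limit with perimeter renormalisation and non-zero string tension | COGNATE (lattice/loop form of existence + confinement; no gap) | Chatterjee 2019 §5 Problem 5.2 | candidate (not yet in tree; vocabulary exists: `infiniteVolumeLimitPoints`, `HasContinuumAreaLawAlong`) | none |
| 9 | weak-coupling area law in `d = 4` for some non-abelian `G` (`CaoParkSheffieldProblem`, cqft.S29) | ∃ non-abelian compact `G ⊆ U(N)`: `HasAreaLaw β` for all large `β` | NOT a strong hypothesis for either problem (confinement; "area law ⇒ gap" unproved; census only) | Cao–Park–Sheffield 2023 §7 (1); Chatterjee Pb 4.1 | registered: no — the decl was MOVED (docstring of `ConstructiveQFTWave0.lean`) to `QuantumFieldTheory/CaoParkSheffield.lean`, a module ABSENT from this tree (no source, no olean) | none |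
| 10 | completion of Balaban's programme: volume-uniform ultraviolet stability of the 4-D lattice YM effective actions PLUS an infrared/large-field completion ⇒ subsequential OS continuum limit | "Balaban + IR ⇒ existence" | would be STRICTLY STRONGER for the existence half of `YangMills` if stated with a gap clause; NO such implication is printed (Balaban CMP 1985–89 stop at UV stability on finite tori; Jaffe–Witten §6.4; Magnen–Rivasseau–Sénéor 1993 for the sketch) | Balaban 1985–1989; MRS 1993 | not typeable (missing notion: a closed statement of "the effective actions converge" — the tree's `ConstructiveQFTBalabanRG*` / `BalabanBanachStep` files carry step FORMATS, not the completed flow) | none |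
| 11 | `∀ N_f` below the conformal window, `QCDOf N_f` | the summit's own remark ("expected to extend to every `N_f` below the conformal window") | would be STRICTLY STRONGER than `QCD` with a trivial landed bridge — but the lower edge `N_f^*` of the conformal window is not known in print, and `∀ N_f ≤ 16, QCDOf N_f` is expected FALSE (IR-conformal, gapless theories in the window), which would make every probe vacuous | Jaffe–Witten §5; lattice reviews | deliberately not stated (parametrised over an unknown threshold; needs `Summits` import anyway) | — |
| 12 | OS reconstruction with gap: OS0–OS4 + exponential clustering ⇒ Wightman theory with `inf σ(H)∖{0} ≥ m` | the passage row 1 ⇒ row 2 | THEOREM, not a hypothesis (in tree as named facts cqft.S06 `IsOSMeasure.exists_isOSFamily`, cqft.S10 `timeClustering_iff_massGap`) | Osterwalder–Schrader 1973/1975; Glimm–Jaffe 1987 §6.1, §19.7 | not registered (theorem) | — |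

## Deliberately NOT registered (and why)

* REFUTER HYPOTHESIS BUNDLES — open statements `H` used summit-side in NEGATIVE lemmas `H → ¬ C`
  (`Literature.MathematicalPhysics.QuantumFieldTheory.TwistSectorInputs`, `….SliceBottleneck`;
  `Summit.QuantumFields.YangMills.Theorems.LatticeGapInUVUnits.Negative.{StandardScalingSU, XiUnbounded,
  FixedTorusTwoSided}`, `….CrossoverCertificate.Negative.{GaplessWeakCouplingLimit, FrozenSU2Limit}`,
  `….TwoPointSynchronisation.Negative.SZZFlowSU2`, `….SusceptibilityToPoincare.Negative.FiniteSusceptibilityMetastableFamily`,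
  `Summit.QuantumFields.YangMills.Cruxes.FiniteSusceptibilityWeakCoupling.Disproof.U1TorusPlaquetteNonSummableD4`,
  `Summit.QuantumFields.QCD.Theorems.PhaseQuenchedFlavourDecayCore.UniformMinorMoments`). They are
  "universally believed" physical pictures WEAKER than or orthogonal to `P` (e.g. `XiUnbounded` is a
  consequence of row 5), chosen so that `H → ¬C` is informative; tagging them `strong_hypothesis` would
  invert the tribunal's reading (a crux implied by a near-certain `H` is near-certain, not summit-strength).
* ANALOGUE MODELS — `ONSigmaModelMassGapConjecture` (2-D `O(N)` σ-model gap, cqft.S26), the barrier-side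
  open statements `Literature.Barriers.QuantumFields.{AbelianMasslessPhaseD4, AbelianPlaquetteMasslessD4,
  NonabelianCoulombPhaseD5, RougheningTransition}`, `QED4Triviality`, `CritIsing3DIsCFT`: other theories;
  no implication to `P`.
* ROUTE CRUXES / `Theses` decls (e.g. `RobustYangMills`, `ThresholdQCD`, `ClusteringToYangMills`, with their
  in-route `… → QCD` / `… → YangMills` assemblies): found by the tribunal's own scan, never tagged here.
* CONSEQUENCES vendored out of `QCD` by D-0015 (3): confinement, chiral symmetry breaking, Banks–Casher,
  Goldstone bounds (`Barriers/QuantumFields/{BanksCasher, GoldstoneTheorem*, CenterSymmetryBreakingByQuarks}`,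
  `QuantumFieldTheory/QCDGoldstoneBound`): weaker / orthogonal, not hypotheses for `P`.

## Sources (keys in `lean/references.bib`)

[JaffeWitten2000] §§1, 4, 5, 6; [JaffeWittenClay2006] §4 (p. 6), §5 (2), §6.5; [ChatterjeeYMProb2019] =
[arXiv180301950] §4 Problem 4.1, §5 Problems 5.1–5.2, §6; [OsterwalderSchraderCMP1973],
[OsterwalderSchraderCMP1975]; [GlimmJaffeQP1987] §6.1, §19.7; [StreaterWightman1964]; [Seiler1982] Ch. 1–3;
[MontvayMunster1994] §5.1; [arXiv230706790] §7; [Balaban1985UV3], [Balaban1987RG1], [Balaban1988Convergent],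
[Balaban1989LargeFieldII]; [MagnenRivasseauSeneor1993].
-/

/-! ## Existing conjecture `def`s, tagged in place (no restatement) -/

attribute [strong_hypothesis "QuantumFields.YangMills"]
  Literature.MathematicalPhysics.QuantumFieldTheory.ClayYangMillsEuclideanGap
  Literature.MathematicalPhysics.QuantumFieldTheory.ClayYangMills
  Literature.MathematicalPhysics.QuantumFieldTheory.ClayYangMillsEuclidean
  Literature.MathematicalPhysics.QuantumFieldTheory.ClayYangMillsEuclideanAlong
  Literature.MathematicalPhysics.QuantumFieldTheory.LatticeMassGapAllCouplings
  Literature.MathematicalPhysics.QuantumFieldTheory.ChatterjeeMassGapProblem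

attribute [strong_hypothesis "QuantumFields.QCD"]
  Literature.MathematicalPhysics.QuantumFieldTheory.QCD

namespace Literature.StrongHypotheses.QuantumFields

/-! ## Newly stated hypotheses

None in this skeleton: no famous conjecture with a printed implication to either bespoke problem
statement is typeable without new mathematics (census rows 8–11). -/

end Literature.StrongHypotheses.QuantumFields
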